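import Summits.ResolutionOfSingularities.KangarooAtlas.MizutaniMoves
import HarnessLib

/-!
# Mizutani's conjecture `m(e) = 2p^e − 1` — the combinatorial cases, I: reduced points and a genuine vertex (`s = 2`)

Cell topic `Summits/ResolutionOfSingularities/KangarooAtlas` (pub-rosobs); namespace
`Summit.ResolutionOfSingularities.KangarooAtlas.Mizutani`.  Part of the Lean transcription of the
in-house note MIZUTANI-PROOF-g59 (AI-written, AI-audited; *AI review is weaker than expert review*; not a
resolution theorem).  Pure combinatorics of a MOVE-CLOSED, ADMISSIBLE set `S` of exponent vectors in the box
`[0,q−1]^ι`, `q = p^e`, containing a GENUINE point (encloser-1 ARCH-e1 §3):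

* `exists_genuine_vertex_two` (`ι = Fin 2`; the note's §6 (α), (β) and the lexicographic vertex of
  THEOREM E): there is a genuine `P ∈ S` which is the UNIQUE minimiser on `S` of the strictly positive weight
  `w = (1, q)`.
* the companion file `MizutaniCasesLayer` treats `s ≥ 3` (a good layer, Cases A/B of THEOREM E(s)).

References: [Mizutani1973HironakaGroupSchemes] (Remark 2.10; in-house proof §6–§7).
-/

open MvPolynomial

namespace Summit.ResolutionOfSingularities.KangarooAtlas.Mizutani

/-! ## Arithmetic of admissible points -/

section Arith

variable {ι : Type*} [Fintype ι] {p : ℕ}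

/-- `|M| = p·floor(M) + Σ (M_i mod p)`. [folklore] -/
theorem degree_eq_floorSum_add_mods (M : ι →₀ ℕ) :
    M.degree = p * floorSum p M + ∑ i, M i % p := by
  rw [Finsupp.degree_eq_sum, floorSum_eq_sum, Finset.mul_sum, ← Finset.sum_add_distrib]
  exact Finset.sum_congr rfl fun i _ => (Nat.div_add_mod (M i) p).symm

/-- `p · floor(M) ≤ |M|`. [folklore] -/
theorem mul_floorSum_le_degree (M : ι →₀ ℕ) : p * floorSum p M ≤ M.degree := by
  rw [degree_eq_floorSum_add_mods (p := p) M]; exact Nat.le_add_right _ _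

omit [Fintype ι] in
/-- An admissible point with small floor is genuine. [cite: Mizutani1973HironakaGroupSchemes, Remark 2.10 (in-house proof §1.2)] -/
theorem isGenuine_of_floorSum_lt {e : ℕ} {M : ι →₀ ℕ} (hB : InBox (p ^ e) M) (hd : p ^ e ≤ M.degree)
    (hf : floorSum p M < p ^ (e - 1)) : IsGenuine p e M := ⟨hB, hd, hf⟩

end Arith

/-! ## Removing a coordinate: degree, floor, box -/

section Remove

variable {n : ℕ} {p : ℕ}

/-- `|M'| + M_c = |M|` for `M'` = `M` without coordinate `c`. [folklore] -/
theorem degree_removeAt_add (c : Fin (n + 1)) (M : Fin (n + 1) →₀ ℕ) :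
    (removeAt c M).degree + M c = M.degree := by
  conv_rhs => rw [← insertAt_removeAt c M, degree_insertAt]
  ring

/-- `floor(M') + ⌊M_c/p⌋ = floor(M)`. [folklore] -/
theorem floorSum_removeAt_add (c : Fin (n + 1)) (M : Fin (n + 1) →₀ ℕ) :
    floorSum p (removeAt c M) + M c / p = floorSum p M := by
  rw [floorSum_eq_sum, floorSum_eq_sum, Fin.sum_univ_succAbove _ c]
  simp only [removeAt_apply]
  ring

/-- `M'` stays in the box. [folklore] -/
theorem inBox_removeAt {q : ℕ} (c : Fin (n + 1)) {M : Fin (n + 1) →₀ ℕ} (hM : InBox q M) :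
    InBox q (removeAt c M) := fun j => by rw [removeAt_apply]; exact hM _

end Remove

/-! ## The reduced point of a genuine point -/

section Reduced

variable {ι : Type*} [DecidableEq ι] [Fintype ι] {p e : ℕ} [Fact p.Prime]

/-- The accumulator bound for a genuine point: `G_a + p Σ_{j≠a} ⌊G_j/p⌋ = p·floor(G) + (G_a mod p) < q`.
[cite: Mizutani1973HironakaGroupSchemes, Remark 2.10 (in-house proof §7 (L4))] -/
theorem accumulator_lt (a : ι) {G : ι →₀ ℕ} (hG : IsGenuine p e G) (he : 1 ≤ e) :
    G a + p * ∑ j ∈ Finset.univ.erase a, G j / p < p ^ e := by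
  have hp : 0 < p := (Fact.out : p.Prime).pos
  have hsum : ∑ j ∈ Finset.univ.erase a, G j / p + G a / p = floorSum p G := by
    rw [floorSum_eq_sum, Finset.sum_erase_add _ _ (Finset.mem_univ a)]
  have hfl := hG.2.2
  have hqa : p ^ e = p * p ^ (e - 1) := by
    rw [← pow_succ']; congr 1; omega
  have hmod : G a % p < p := Nat.mod_lt _ hp
  have hGa := Nat.div_add_mod (G a) p
  have : p * (∑ j ∈ Finset.univ.erase a, G j / p + G a / p) + p ≤ p * p ^ (e - 1) := by
    rw [hsum, ← mul_add_one]; exact Nat.mul_le_mul_left p hfl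
  rw [hqa]
  linarith [mul_add p (∑ j ∈ Finset.univ.erase a, G j / p) (G a / p)]

/-- **The reduced point** (MIZUTANI-PROOF-g59 §7 (L4)): in a move-closed set containing a genuine `G`,
the point `P⁰` with `P⁰_a = p·floor(G) + (G_a mod p)`, `P⁰_j = G_j mod p` (`j ≠ a`) lies in the set,
with the same degree and floor. [cite: Mizutani1973HironakaGroupSchemes, Remark 2.10 (in-house proof §7 (L4))] -/
theorem exists_reduced_point {S : Finset (ι →₀ ℕ)} (hS : MoveClosed p (p ^ e) S) (a : ι) {G : ι →₀ ℕ}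
    (hGS : G ∈ S) (hG : IsGenuine p e G) (he : 1 ≤ e) :
    ∃ P ∈ S, P a = p * floorSum p G + G a % p ∧ (∀ j, j ≠ a → P j = G j % p) ∧
      P.degree = G.degree ∧ floorSum p P = floorSum p G ∧ InBox (p ^ e) P := by
  have hp : 0 < p := (Fact.out : p.Prime).pos
  have hlt := accumulator_lt a hG he
  obtain ⟨P, hPS, hPa, hPJ, -, hdeg, hfl⟩ :=
    exists_reduced hS a (Finset.univ.erase a) (Finset.notMem_erase a _) G hGS hlt
  have hPa' : P a = p * floorSum p G + G a % p := by
    rw [hPa, floorSum_eq_sum, ← Finset.sum_erase_add _ _ (Finset.mem_univ a), mul_add]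
    have := Nat.div_add_mod (G a) p
    omega
  refine ⟨P, hPS, hPa', fun j hj => hPJ j (Finset.mem_erase.mpr ⟨hj, Finset.mem_univ j⟩), hdeg, hfl, ?_⟩
  intro l
  by_cases hl : l = a
  · subst hl; rw [hPa]; exact hlt
  · rw [hPJ l (Finset.mem_erase.mpr ⟨hl, Finset.mem_univ l⟩)]
    calc G l % p < p := Nat.mod_lt _ hp
      _ ≤ p ^ e := by
        calc p = p ^ 1 := (pow_one p).symm
          _ ≤ p ^ e := Nat.pow_le_pow_right hp he

end Reduced

/-! ## `s = 2`: a genuine vertex -/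

section Two

variable {p e : ℕ} [Fact p.Prime]

/-- The lexicographic weight `(1, q)` on `Fin 2`. [cite: Mizutani1973HironakaGroupSchemes, Remark 2.10 (in-house proof §6, w = (1,q))] -/
def lexWeight (q : ℕ) : Fin 2 → ℕ := fun i => if i = 0 then 1 else q

/-- The lexicographic weight is strictly positive (for `q ≥ 1`). [folklore] -/
theorem lexWeight_pos {q : ℕ} (hq : 0 < q) (i : Fin 2) : 0 < lexWeight q i := by
  unfold lexWeight; split_ifs <;> omega

/-- `w · M = M_0 + q M_1`. [folklore] -/
theorem wdeg_lexWeight (q : ℕ) (M : Fin 2 →₀ ℕ) : wdeg (lexWeight q) M = M 0 + q * M 1 := by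
  simp [wdeg, lexWeight, Fin.sum_univ_two]

/-- The lexicographic weight is injective on the box. [folklore] -/
theorem eq_of_wdeg_lexWeight_eq {q : ℕ} {M N : Fin 2 →₀ ℕ} (hM : InBox q M) (hN : InBox q N)
    (h : wdeg (lexWeight q) M = wdeg (lexWeight q) N) : M = N := by
  rw [wdeg_lexWeight, wdeg_lexWeight] at h
  have h0 := hM 0
  have h0' := hN 0
  have hq : 0 < q := by omega
  have e1 : M 1 = N 1 := by
    have h2 : (M 0 + q * M 1) / q = (N 0 + q * N 1) / q := by rw [h]
    rwa [Nat.add_mul_div_left _ _ hq, Nat.add_mul_div_left _ _ hq, Nat.div_eq_of_lt h0,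
      Nat.div_eq_of_lt h0', zero_add, zero_add] at h2
  have e0 : M 0 = N 0 := by rw [e1] at h; omega
  ext i
  fin_cases i
  · exact e0
  · exact e1

/-- **A genuine vertex for two directions** (MIZUTANI-PROOF-g59 §6 (α), (β), THEOREM E): a move-closed,
admissible set in `[0,q−1]^2` containing a genuine point contains a GENUINE point which is the unique
minimiser of the weight `(1, q)`.  (β): from the reduced point `(pΦ + r_0, r_1)` pour `p − 1 − r_0` units
into coordinate `0`, reaching `(q − 1, c + 1)`; (α): every admissible point with second coordinate
`≤ p − 1` is genuine. [cite: Mizutani1973HironakaGroupSchemes, Remark 2.10 (in-house proof §6, Theorem E)] -/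
theorem exists_genuine_vertex_two (he : 1 ≤ e) {S : Finset (Fin 2 →₀ ℕ)} (hS : MoveClosed p (p ^ e) S)
    (hadm : ∀ M ∈ S, InBox (p ^ e) M ∧ p ^ e ≤ M.degree) (hgen : ∃ G ∈ S, IsGenuine p e G) :
    ∃ P ∈ S, IsGenuine p e P ∧
      ∀ M ∈ S, M ≠ P → wdeg (lexWeight (p ^ e)) P < wdeg (lexWeight (p ^ e)) M := by
  have hp : 0 < p := (Fact.out : p.Prime).pos
  have hp1 : 1 ≤ p := hp
  obtain ⟨G, hGS, hG⟩ := hgen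
  have hqe : p ^ e = p * p ^ (e - 1) := by rw [← pow_succ']; congr 1; omega
  -- the reduced point `(pΦ + r₀, r₁)`
  obtain ⟨P₀, hP₀S, hP₀a, hP₀j, hdeg₀, hfl₀, hbox₀⟩ := exists_reduced_point hS (0 : Fin 2) hGS hG he
  have h10 : (1 : Fin 2) ≠ 0 := by decide
  have hP₀1 : P₀ 1 = G 1 % p := hP₀j 1 h10
  have hr0 : G 0 % p < p := Nat.mod_lt _ hp
  have hr1 : G 1 % p < p := Nat.mod_lt _ hp
  -- `r₀ + r₁ ≥ p` and `pΦ ≤ q − p`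
  have hdegG : G.degree = G 0 + G 1 := by rw [Finsupp.degree_eq_sum, Fin.sum_univ_two]
  have hflG : floorSum p G = G 0 / p + G 1 / p := by rw [floorSum_eq_sum, Fin.sum_univ_two]
  have hfl_le : floorSum p G + 1 ≤ p ^ (e - 1) := hG.2.2
  have hdeg_ge : p ^ e ≤ G.degree := hG.2.1
  have hd0 := Nat.div_add_mod (G 0) p
  have hd1 := Nat.div_add_mod (G 1) p
  have hsum : p ≤ G 0 % p + G 1 % p := by
    have : p * (floorSum p G + 1) ≤ p * p ^ (e - 1) := Nat.mul_le_mul_left p hfl_le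
    rw [hflG, mul_add, mul_add, mul_one] at this
    omega
  -- pour `u = p − 1 − r₀` units from coordinate 1 into 0
  set u := p - 1 - G 0 % p with hu
  obtain ⟨A, hAS, hA1, hA0, -, hdegA, -⟩ := exists_pour hS (1 : Fin 2) (fun _ => u) {0}
    (by decide) P₀ hP₀S (by rw [hP₀1]; exact hr1) (by rw [Finset.sum_singleton, hP₀1]; omega)
    (by
      intro j hj
      rw [Finset.mem_singleton] at hj
      subst hj
      rw [hP₀a]
      have : p * floorSum p G + G 0 % p + u = p * (floorSum p G + 1) - 1 := by
        rw [mul_add, mul_one]; omega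
      rw [this, hqe]
      have : p * (floorSum p G + 1) ≤ p * p ^ (e - 1) := Nat.mul_le_mul_left p hfl_le
      have hpos : 0 < p * (floorSum p G + 1) := Nat.mul_pos hp (Nat.succ_pos _)
      omega)
  rw [Finset.sum_singleton] at hA1
  have hA0' : A 0 = P₀ 0 + u := hA0 0 (Finset.mem_singleton_self 0)
  -- `A = (q − 1, r₀ + r₁ + 1 − p)`, so `A 1 ≤ p − 1`
  have hA1_le : A 1 + 1 ≤ p := by rw [hA1, hP₀1]; omega
  have hA0_lt : A 0 < p ^ e := (hadm A hAS).1 0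
  -- the minimiser of the lexicographic weight
  obtain ⟨P, hPS, hPmin⟩ := Finset.exists_min_image S (fun M => wdeg (lexWeight (p ^ e)) M) ⟨G, hGS⟩
  have hPle : wdeg (lexWeight (p ^ e)) P ≤ wdeg (lexWeight (p ^ e)) A := hPmin A hAS
  rw [wdeg_lexWeight, wdeg_lexWeight] at hPle
  have hP1 : P 1 ≤ A 1 := by
    by_contra hlt
    push Not at hlt
    have : p ^ e * (A 1 + 1) ≤ p ^ e * P 1 := Nat.mul_le_mul_left _ hlt
    rw [mul_add, mul_one] at this
    omega
  have hBox := (hadm P hPS).1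
  refine ⟨P, hPS, isGenuine_of_floorSum_lt hBox (hadm P hPS).2 ?_, fun M hM hne => ?_⟩
  · -- (α): second coordinate `≤ p − 1`
    rw [floorSum_eq_sum, Fin.sum_univ_two, Nat.div_eq_of_lt (by omega : P 1 < p), add_zero]
    have h0 : P 0 < p ^ e := hBox 0
    rw [hqe] at h0
    exact Nat.div_lt_of_lt_mul h0
  · exact lt_of_le_of_ne (hPmin M hM) fun h =>
      hne (eq_of_wdeg_lexWeight_eq (hadm M hM).1 hBox h.symm)

end Two

end Summit.ResolutionOfSingularities.KangarooAtlas.Mizutani
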